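import Mathlib
import HarnessLib

/-!
# JOINT convergence of INDEPENDENT VECTOR-valued replica statistics: `X_{r,n} ⇒ ν_r` in a finite-dimensional inner product space `E_r` for each replica ⇒ `(X_{r,n})_r ⇒ ⊗_r ν_r` under the product law

HONEST FRAMING: exact (Metropolis-corrected) sampling algorithms for lattice gauge theory;
figures of merit are autocorrelation/cost numbers at stated couplings and volumes; no
continuum-physics claim.

Venture `LatticeQCDFlow` (cell pub-lqcd), topic `Exactness`; FANOUT row 13 (`eng-snf`, GEN-25).
NEW WORK of the cell (classical; not in Mathlib) against Mathlib only (`MeasureTheory.charFun_pi`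
on `PiLp 2`, Lévy's continuity theorem `ProbabilityMeasure.tendsto_iff_tendsto_charFun`,
`integral_fintype_prod_eq_prod`); no definition; nothing cited as a fact.

WHY (row 13).  GEN-23 `NCMCGeneralSpaceReplicaVectorCLT.tendstoInDistribution_pi_toLp` (and row 4's
`Scoring/IndependentFamilyJointLimit`) give the joint limit of `R` independent REAL replica
statistics with Gaussian limits; row 4's `Scoring/IndependentJointLimitVector` treats TWO
vector-valued statistics.  GEN-25's `NCMCGeneralSpaceReplicaJackknifeFDeriv` (the jackknife of a
smooth function of SEVERAL pooled means) takes as hypothesis the joint convergence of the `R`-vector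
of `E`-VALUED scaled block estimates `(√n (A_{n,r} − a))_r ⇒ Z`; for independent streams each
obeying a multivariate CLT that hypothesis is exactly this file's conclusion.  Stated for arbitrary
limit laws `ν_r` (not only Gaussian) and arbitrary finite-dimensional real inner product spaces
`E_r` (one per replica): if `X_{r,n} ⇒ ν_r` under `P_r` for every `r`, then under the product law
`⊗_r P_r` the vector `(X_{r,n}(ω_r))_r`, read in the Hilbert product `PiLp 2 E`, converges in
distribution to the canonical variable `toLp 2` on `(Π_r E_r, ⊗_r ν_r)`; the same in the plain
product `Π_r E_r`, and for continuous functionals.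

* `charFun_pi_map_toLp_vector` — `φ_{(X_r)_r}(t) = Π_r φ_{X_r}(t_r)` under a product law (vector
  coordinates);
* **`tendstoInDistribution_pi_toLp_vector`** — the joint limit in `PiLp 2 E`;
* **`tendstoInDistribution_pi_vector`** — the same in `Π_r E_r`; `…_comp_of_continuous`.
* `pi_map_clm_eq_pi_gaussianReal`, **`map_scores_eq_pi_gaussianReal`** (§2) — scores `(L Z_r)_r`
  of a product of (centred) Gaussian laws on `E` are `N(0, Var_μ L)^{⊗R}` (the score hypothesis
  of `…ReplicaJackknifeFDeriv`).

NOT CLAIMED: dependent replicas; infinitely many replicas; rates.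
-/

namespace Summit.Ventures.LatticeQCDFlow.Exactness.GeneralNCMC

open MeasureTheory ProbabilityTheory Filter Finset WithLp Complex
open scoped ENNReal NNReal Topology RealInnerProductSpace

section Vector

variable {ι : Type*} [Fintype ι] {Ω : ι → Type*} [∀ r, MeasurableSpace (Ω r)]
  {P : (r : ι) → Measure (Ω r)} [∀ r, IsProbabilityMeasure (P r)]
  {E : ι → Type*} [∀ r, NormedAddCommGroup (E r)] [∀ r, InnerProductSpace ℝ (E r)]
  [∀ r, FiniteDimensional ℝ (E r)] [∀ r, MeasurableSpace (E r)] [∀ r, BorelSpace (E r)]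

/-- **`φ_{(X_r)_r}(t) = Π_r φ_{X_r}(t_r)` under a product law**, for replica statistics with values
in inner product spaces `E_r` (the vector read in `PiLp 2 E`). -/
theorem charFun_pi_map_toLp_vector {X : (r : ι) → Ω r → E r} (hX : ∀ r, Measurable (X r))
    (t : PiLp 2 E) :
    charFun ((Measure.pi P).map fun ω : (r : ι) → Ω r => toLp 2 (fun r => X r (ω r))) t
      = ∏ r, charFun ((P r).map (X r)) (t r) := by
  have hV : Measurable fun (ω : (r : ι) → Ω r) (r : ι) => X r (ω r) :=
    measurable_pi_lambda _ fun r => (hX r).comp (measurable_pi_apply r)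
  have hm : Measurable fun ω : (r : ι) → Ω r => toLp 2 (fun r => X r (ω r)) :=
    (MeasurableEquiv.toLp 2 ((r : ι) → E r)).measurable.comp hV
  rw [charFun_apply, integral_map hm.aemeasurable (by fun_prop)]
  have h2 : ∀ r, charFun ((P r).map (X r)) (t r)
      = ∫ ω, Complex.exp ((⟪X r ω, t r⟫ : ℂ) * I) ∂(P r) := by
    intro r
    rw [charFun_apply, integral_map (hX r).aemeasurable (by fun_prop)]
  simp only [h2]
  rw [← integral_fintype_prod_eq_prod
    (fun r (ω : Ω r) => Complex.exp ((⟪X r ω, t r⟫ : ℂ) * I))]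
  refine integral_congr_ae (Eventually.of_forall fun ω => ?_)
  dsimp only
  rw [PiLp.inner_apply, ← Complex.exp_sum]
  congr 1
  push_cast
  rw [Finset.sum_mul]

/-- **INDEPENDENT VECTOR-VALUED LIMITS, JOINTLY**: if `X_{r,n} ⇒ ν_r` under `P_r` for every replica
`r` (canonical limit variable `id` on `(E_r, ν_r)`), then under the product law the vector
`(X_{r,n}(ω_r))_r ∈ PiLp 2 E` converges in distribution to `toLp 2` on `(Π_r E_r, ⊗_r ν_r)`
(Lévy: the characteristic functions factorise on both sides). -/
theorem tendstoInDistribution_pi_toLp_vector {X : (r : ι) → ℕ → Ω r → E r}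
    (hX : ∀ r n, Measurable (X r n)) {ν : (r : ι) → Measure (E r)} [∀ r, IsProbabilityMeasure (ν r)]
    (h : ∀ r, TendstoInDistribution (X r) atTop id (fun _ => P r) (ν r)) :
    TendstoInDistribution (fun (n : ℕ) (ω : (r : ι) → Ω r) => toLp 2 (fun r => X r n (ω r))) atTop
      (toLp 2) (fun _ => Measure.pi P) (Measure.pi ν) := by
  have hm : ∀ n, Measurable fun ω : (r : ι) → Ω r => toLp 2 (fun r => X r n (ω r)) := fun n =>
    (MeasurableEquiv.toLp 2 ((r : ι) → E r)).measurable.comp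
      (measurable_pi_lambda _ fun r => (hX r n).comp (measurable_pi_apply r))
  refine ⟨fun n => (hm n).aemeasurable,
    (MeasurableEquiv.toLp 2 ((r : ι) → E r)).measurable.aemeasurable, ?_⟩
  refine ProbabilityMeasure.tendsto_iff_tendsto_charFun.2 fun t => ?_
  have hL : ∀ n : ℕ, charFun ((Measure.pi P).map fun ω : (r : ι) → Ω r =>
      toLp 2 (fun r => X r n (ω r))) t = ∏ r, charFun ((P r).map (X r n)) (t r) := fun n =>
    charFun_pi_map_toLp_vector (fun r => hX r n) t
  have hR : charFun ((Measure.pi ν).map (toLp 2)) t = ∏ r, charFun (ν r) (t r) := charFun_pi t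
  simp only [ProbabilityMeasure.coe_mk, hL, hR]
  refine tendsto_finsetProd _ fun r _ => ?_
  have hr := (ProbabilityMeasure.tendsto_iff_tendsto_charFun.1 (h r).tendsto) (t r)
  simp only [ProbabilityMeasure.coe_mk, Measure.map_id] at hr
  exact hr

/-- **The same in the plain product `Π_r E_r`** (sup norm): `(X_{r,n}(ω_r))_r ⇒ id` on
`(Π_r E_r, ⊗_r ν_r)` — the form taken as hypothesis by `NCMCGeneralSpaceReplicaJackknifeFDeriv`. -/
theorem tendstoInDistribution_pi_vector {X : (r : ι) → ℕ → Ω r → E r}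
    (hX : ∀ r n, Measurable (X r n)) {ν : (r : ι) → Measure (E r)} [∀ r, IsProbabilityMeasure (ν r)]
    (h : ∀ r, TendstoInDistribution (X r) atTop id (fun _ => P r) (ν r)) :
    TendstoInDistribution (fun (n : ℕ) (ω : (r : ι) → Ω r) (r : ι) => X r n (ω r)) atTop
      id (fun _ => Measure.pi P) (Measure.pi ν) := by
  have h1 := (tendstoInDistribution_pi_toLp_vector hX h).continuous_comp
    (g := fun x : PiLp 2 E => (ofLp x : (r : ι) → E r)) (PiLp.continuous_ofLp 2 E)
  exact h1

/-- **Continuous functionals of the replica vector** converge to the functional of `⊗_r ν_r`. -/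
theorem tendstoInDistribution_pi_vector_comp_of_continuous {X : (r : ι) → ℕ → Ω r → E r}
    (hX : ∀ r n, Measurable (X r n)) {ν : (r : ι) → Measure (E r)} [∀ r, IsProbabilityMeasure (ν r)]
    (h : ∀ r, TendstoInDistribution (X r) atTop id (fun _ => P r) (ν r))
    {F : Type*} [TopologicalSpace F] [MeasurableSpace F] [BorelSpace F]
    {g : ((r : ι) → E r) → F} (hg : Continuous g) :
    TendstoInDistribution (fun (n : ℕ) (ω : (r : ι) → Ω r) => g (fun r => X r n (ω r))) atTop
      g (fun _ => Measure.pi P) (Measure.pi ν) :=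
  (tendstoInDistribution_pi_vector hX h).continuous_comp hg

end Vector

/-! ## §2 Gaussian scores: linear forms of independent Gaussian limits -/

section Scores

variable {ι : Type*} [Fintype ι] {E : Type*} [NormedAddCommGroup E] [NormedSpace ℝ E]
  [MeasurableSpace E] [BorelSpace E]

/-- **Scores of a product of Gaussian laws**: under `⊗_r μ` with `μ` Gaussian on `E`, the vector
`(L z_r)_r` of values of a continuous linear form has law `⊗_r N(μ[L], Var_μ L)`. -/
theorem pi_map_clm_eq_pi_gaussianReal (μ : Measure E) [IsGaussian μ] (L : E →L[ℝ] ℝ) :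
    (Measure.pi fun _ : ι => μ).map (fun (z : ι → E) (r : ι) => L (z r))
      = Measure.pi fun _ : ι => gaussianReal (∫ x, L x ∂μ) (Var[L; μ]).toNNReal := by
  rw [Measure.pi_map_pi (fun _ => L.continuous.measurable.aemeasurable)]
  congr 1
  funext r
  exact IsGaussian.map_eq_gaussianReal L

/-- **The score hypothesis of `NCMCGeneralSpaceReplicaJackknifeFDeriv` from a Gaussian limit**:
if the limit variable `Z : Ω' → (ι → E)` has law `⊗_r μ` with `μ` a CENTRED Gaussian on `E`
(`μ[L] = 0`), then the score vector `(L (Z r))_r` has law `N(0, Var_μ L)^{⊗R}` under `P'`. -/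
theorem map_scores_eq_pi_gaussianReal {Ω' : Type*} [MeasurableSpace Ω'] {P' : Measure Ω'}
    {Z : Ω' → ι → E} (hZ : AEMeasurable Z P') (μ : Measure E) [IsGaussian μ]
    (hlaw : P'.map Z = Measure.pi fun _ : ι => μ) (L : E →L[ℝ] ℝ) (hL0 : ∫ x, L x ∂μ = 0) :
    P'.map (fun ω' r => L (Z ω' r))
      = Measure.pi fun _ : ι => gaussianReal 0 (Var[L; μ]).toNNReal := by
  have hc : Measurable fun (z : ι → E) (r : ι) => L (z r) :=
    measurable_pi_lambda _ fun r => L.continuous.measurable.comp (measurable_pi_apply r)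
  have hcomp : (fun ω' r => L (Z ω' r)) = (fun (z : ι → E) (r : ι) => L (z r)) ∘ Z := rfl
  rw [hcomp, ← AEMeasurable.map_map_of_aemeasurable hc.aemeasurable hZ, hlaw,
    pi_map_clm_eq_pi_gaussianReal, hL0]

end Scores

end Summit.Ventures.LatticeQCDFlow.Exactness.GeneralNCMC
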